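/-
Copyright (c) 2026. All rights reserved.
Released under Apache 2.0 license as described in the file LICENSE.
Authors: abc-iut cell, prover seat abc-iut-L4-t10 (gen 14; row «COR510iv-HOL-MONO-CLOSE», abc-iut-L4-lead m174 (2)), over
abc-iut-L4-d3's typed sentence (`LogFrobeniusMonoTelecoreHolCompatible`), abc-iut-f-101's `monoTelecore` / `DiagramSinkSystems` /
`DiagramPathEmbeddings` / `LiftPair`, abc-iut-L4-t5's `univFamily` and this seat's files 1–2 (consumed BY NAME, nothing restated).
-/
import Literature.AnabelianGeometry.AbsoluteAnabelian.LogFrobeniusHolMonoSuperTransfer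
import Literature.AnabelianGeometry.AbsoluteAnabelian.DiagramSinkSystems
import HarnessLib

/-!
# [AbsTopIII] Cor 5.10 (iv)(c): the sink system of the common super-diagram — `An•[𝒳]` and `An⊢[𝒩⊢⊞]` — and the family `K`

S. Mochizuki, *Topics in absolute anabelian geometry III: global reconstruction algorithms* [MochizukiAbsTopIII2015];
manuscript `paper:url-5493eb38cbb7`, read on the page: Cor 5.10 (iv)(c) p. 148 l. 41–45 («… a contact structure `ℋ_{An⊢}` on `𝔗_{An⊢}` that
is compatible with the telecore and contact structures `𝔗_{An•}`, `ℋ_{An•}` of Corollary 5.5, (ii)»), Def 3.5 (ii) p. 75 («compatible» =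
contained in ONE family of homotopies), (iv) p. 76 (telecore pairs `([γ₃]∘[γ₁], [γ₃]∘[γ₂])`), Rmk 3.5.1 p. 78 (structure functors).

PROOF-SIDE file 3/4 of the CLOSER of abc-iut-L4-d3's `LogFrobeniusSetting.Cor510MonoContactHolCompatible` (row «COR510iv-HOL-MONO-CLOSE»).
Construction (abc-iut-f-101's sink-system method, `DiagramSinkSystems`): on the common super-diagram (file 1's `supDiagram` = abc-iut-L4-d3's
`holMonoDiagram` at the printed telecore edges) flag the two core vertices `An•[𝒳]` and `An⊢[𝒩⊢⊞]`; the sink at `An⊢` is ALL pairs with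
abc-iut-L4-t5's lifts through the identity structure functor of file 1's `supOver`; the sink at `An•[𝒳]` is the universal family of
`D_{An•}` (lifts through `κ_{An•}⁻¹` over `Th•[Z]`, abc-iut-L4-t5) read in the super-diagram along the sieve `embHolSuper` (abc-iut-f-101's
`LiftPair`); the one interaction — PUSHING a pair at `An•[𝒳]` along a path into `An⊢` gives the lift there — holds because every sink
homotopy LIES OVER the core (file 2's ★ `isOver_sup_of_isOver_hol`) and the lift is the unique such transformation (Rmk 3.5.1); a loop at
`An•[𝒳]` is a loop of `D_{An•}` (the sieve), along which the universal family is closed; no path returns from `An⊢` to `An•[𝒳]` (file 1).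

* `holUniv`, `holUniv_isOver` — the universal family of `D_{An•}` on the pulled-back presentation, its homotopies over `Th•[Z]`;
* `supSink`, `supSink_η_self/_trans/_precomp`, `isOver_supSinkη`, `supSink_push_monoCore`, `supSink_push_holCore`, `supSink_push`;
* `supSinkSystem`, ★ `holMonoFamily` — the family `K` on the common super-diagram (Def 3.5 (ii) PROVED by the sink-system theory).

File 4 (`LogFrobeniusMonoTelecoreHolCompatibleOf`) shows `K ⊇ 𝒥_{An⊢}, 𝒥_{An•}` along the two inclusions and closes the typed sentence.
OUR kernel constructions over abc-iut-L4-t3's typed §5 interface ((a) `hN`, (c) `hψ` as hypotheses); refereed pre-IUT material; nothing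
here bears on [IUTchIII] Cor. 3.12; no side taken; typed ≠ proved.
-/

set_option autoImplicit false

universe u

open CategoryTheory Quiver

namespace Literature.AnabelianGeometry.AbsoluteAnabelian

namespace LogFrobeniusSetting

open DiagramOfCategories

variable {Vmod : Type u} {isArc : Vmod → Bool} (L : LogFrobeniusSetting Vmod isArc)

/-! ## The two sinks: `An•[𝒳]` (the universal family of `D_{An•}` read along the sieve) and `An⊢[𝒩⊢⊞]` (all pairs, the lifts) -/

section Sinks

variable (hN : ∀ v : Vmod, L.monoN v ⋙ L.toEmono v ≅ L.toE v ⋙ L.monoAn)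
  (hψ : ∀ (w : Vmod) (j : {ν : LogVertex (isArc w) // ν.IsCross}),
    L.ψAnMono w j ⋙ L.forgetMono w ⋙ L.toEmono w ≅ L.κAnMono.inverse)

/-- The flagged vertices of the super-diagram: the two core vertices `An•[𝒳]` and `An⊢[𝒩⊢⊞]`.
[cite: MochizukiAbsTopIII2015, Cor 5.10 (iv)(c) p. 148] -/
def isObsSup : (supShape Vmod isArc).Vertex → Bool
  | ExtVertex.obs => true
  | ExtVertex.base ExtVertex.obs => true
  | ExtVertex.base (ExtVertex.base _) => false

/-- The fully faithful vertices of `D_{An•}` for its universal family: the core vertex `An•[𝒳]` (`κ_{An•}⁻¹`).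
[cite: MochizukiAbsTopIII2015, Definition 3.5 (iv) p.76] -/
noncomputable def holW_ff (w : (anShape (Vmod := Vmod) (isArc := isArc)).Vertex)
    (hw : w = (anShape (Vmod := Vmod) (isArc := isArc)).obs) : (L.holOverE.N w).FullyFaithful := by
  subst hw
  exact L.holOverE_ff_obs

/-- **The universal family of `D_{An•}`** (lifts at `An•[𝒳]` through `κ_{An•}⁻¹`, whiskered; abc-iut-L4-t5's `univFamily`) on the
pulled-back presentation — the telecore family `𝒥_{An•}` extended to all suffixes of the super-diagram's sub-graph.
[cite: MochizukiAbsTopIII2015, Cor 5.5 (ii) p. 130] -/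
noncomputable def holUniv : (L.supDiagram.comapAlong (embHol Vmod isArc)).HomotopyFamily :=
  univFamily L.holOverE (· = (anShape (Vmod := Vmod) (isArc := isArc)).obs) L.holW_ff

/-- Every homotopy of the universal family of `D_{An•}` lies over `Th•[Z]` (a whiskered lift; Rmk 3.5.1).
[cite: MochizukiAbsTopIII2015, Remark 3.5.1 p.78] -/
theorem holUniv_isOver {a b : (anShape (Vmod := Vmod) (isArc := isArc)).Vertex} {P Q : Path a b} (h : L.holUniv.E P Q) :
    L.holOverE.IsOver P Q (L.holUniv.η h) := by
  rcases id h with ⟨⟨w, hw, p, q, s, hP, hQ⟩⟩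
  subst hP hQ
  rw [show L.holUniv.η h = _ from univFamily_η_eq L.holOverE _ L.holW_ff h ⟨w, hw, p, q, s, rfl, rfl⟩]
  exact (OverData.isOver_lift (O := L.holOverE) (L.holW_ff w hw) p q).whiskerRight s

/-- A sink pre-family at one vertex of the super-diagram (members and homotopies). [cite: MochizukiAbsTopIII2015, Definition 3.5 (ii) p.75] -/
structure SupSinkAt (n : (supShape Vmod isArc).Vertex) where
  /-- member pairs into `n` -/
  E : ∀ {a : (supShape Vmod isArc).Vertex}, Path a n → Path a n → Prop
  /-- their homotopies -/
  η : ∀ {a : (supShape Vmod isArc).Vertex} {p q : Path a n}, E p q → (L.supDiagram.pathFunctor p ⟶ L.supDiagram.pathFunctor q)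

/-- **The sinks of the super-diagram**: at `An•[𝒳]` the universal family of `D_{An•}` read along the sieve `embHolSuper` (abc-iut-f-101's
`LiftPair` / `liftη`); at `An⊢[𝒩⊢⊞]` ALL pairs with the lifts through the identity structure functor; nothing elsewhere.
[cite: MochizukiAbsTopIII2015, Cor 5.10 (iv)(c) p. 148] -/
noncomputable def supSink : ∀ n : (supShape Vmod isArc).Vertex, L.SupSinkAt n
  | ExtVertex.obs => ⟨fun p q => liftE (embHol Vmod isArc) L.supDiagram (anShape (Vmod := Vmod) (isArc := isArc)).obs L.holUniv p q,
      fun h => liftη (embHol Vmod isArc) L.supDiagram (anShape (Vmod := Vmod) (isArc := isArc)).obs L.holUniv h⟩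
  | ExtVertex.base ExtVertex.obs => ⟨fun _ _ => True, fun {_} {p} {q} _ => (L.supOver hN hψ).lift (L.supOver_ff_monoCore hN hψ) p q⟩
  | ExtVertex.base (ExtVertex.base _) => ⟨fun _ _ => False, fun h => h.elim⟩

/-- Members live at the two flagged vertices only. [cite: MochizukiAbsTopIII2015, Cor 5.10 (iv)(c) p. 148] -/
theorem isObsSup_of_mem {a n : (supShape Vmod isArc).Vertex} {p q : Path a n} (h : (L.supSink hN hψ n).E p q) :
    isObsSup n = true := by
  rcases n with (_ | _) | _
  · exact (h : False).elim
  · rfl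
  · rfl

/-- Components of a transformation heterogeneously equal to a left whiskering (bookkeeping). [folklore] -/
private theorem app_eq_of_heq_whiskerLeft {A B C : Type*} [Category A] [Category B] [Category C] {R : A ⥤ B}
    {P Q : B ⥤ C} {P' Q' : A ⥤ C} (hP : P' = R ⋙ P) (hQ : Q' = R ⋙ Q) {θ : P ⟶ Q} {θ' : P' ⟶ Q'}
    (h : HEq θ' (Functor.whiskerLeft R θ)) (x : A) (hx₁ : P'.obj x = P.obj (R.obj x))
    (hx₂ : Q.obj (R.obj x) = Q'.obj x) : θ'.app x = eqToHom hx₁ ≫ θ.app (R.obj x) ≫ eqToHom hx₂ := by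
  subst hP hQ; cases h
  exact (eq_of_heq (DiagramOfCategories.HomotopyFamily.heq_eqToHom_comp_comp_eqToHom hx₁ hx₂ _)).symm

/-- `η_self` for the sinks (Def. 3.5 (ii): identity on diagonal members). [cite: MochizukiAbsTopIII2015, Definition 3.5 (ii) p.75] -/
theorem supSink_η_self {a n : (supShape Vmod isArc).Vertex} {p : Path a n} (h : (L.supSink hN hψ n).E p p) :
    (L.supSink hN hψ n).η h = 𝟙 _ := by
  rcases n with (_ | _) | _
  · exact (h : False).elim
  · exact (L.supOver hN hψ).lift_self _ _
  · exact liftη_self graphEmbedding_embHol _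

/-- `trans` for the sinks (Def. 3.5 (ii): composition). [cite: MochizukiAbsTopIII2015, Definition 3.5 (ii) p.75] -/
theorem supSink_trans {a n : (supShape Vmod isArc).Vertex} {p q r : Path a n} (h₁ : (L.supSink hN hψ n).E p q)
    (h₂ : (L.supSink hN hψ n).E q r) :
    ∃ h₃ : (L.supSink hN hψ n).E p r, (L.supSink hN hψ n).η h₃ = (L.supSink hN hψ n).η h₁ ≫ (L.supSink hN hψ n).η h₂ := by
  rcases n with (_ | _) | _
  · exact (h₁ : False).elim
  · exact ⟨trivial, ((L.supOver hN hψ).lift_trans _ p q r).symm⟩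
  · exact lift_trans graphEmbedding_embHol h₁ h₂

/-- `precomp` for the sinks (Def. 3.5 (ii): pre-whiskering; at `An•[𝒳]` the path lifts along the sieve, at `An⊢` abc-iut-L4-t5's
`lift_precomp_heq`). [cite: MochizukiAbsTopIII2015, Definition 3.5 (ii) p.75] -/
theorem supSink_precomp {c a n : (supShape Vmod isArc).Vertex} {p q : Path a n} (h : (L.supSink hN hψ n).E p q) (r : Path c a) :
    ∃ h' : (L.supSink hN hψ n).E (r.comp p) (r.comp q), ∀ x : L.supDiagram.obj c,
      ((L.supSink hN hψ n).η h').app x = eqToHom (L.supDiagram.pathFunctor_comp_obj r p x) ≫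
        ((L.supSink hN hψ n).η h).app ((L.supDiagram.pathFunctor r).obj x) ≫
          eqToHom (L.supDiagram.pathFunctor_comp_obj r q x).symm := by
  rcases n with (_ | _) | _
  · exact (h : False).elim
  · exact ⟨trivial, fun x => app_eq_of_heq_whiskerLeft (L.supDiagram.pathFunctor_comp r p)
      (L.supDiagram.pathFunctor_comp r q) ((L.supOver hN hψ).lift_precomp_heq _ r p q) x _ _⟩
  · exact lift_precomp graphEmbedding_embHol isSieve_embHol h r

/-- **Every sink homotopy lies over the core `An⊢[𝒩⊢⊞]`** (the lifts at `An⊢` by construction; at `An•[𝒳]` by file 2's ★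
`isOver_sup_of_isOver_hol` — the universal homotopies of `D_{An•}` lie over `Th•[Z]`). [cite: MochizukiAbsTopIII2015, Remark 3.5.1 p.78] -/
theorem isOver_supSinkη {a n : (supShape Vmod isArc).Vertex} {p q : Path a n} (h : (L.supSink hN hψ n).E p q) :
    (L.supOver hN hψ).IsOver p q ((L.supSink hN hψ n).η h) := by
  rcases n with (_ | _) | _
  · exact (h : False).elim
  · exact (L.supOver hN hψ).isOver_lift _ p q
  · obtain ⟨w₀⟩ := h
    obtain ⟨src, left, right, mem, hs, hl, hr⟩ := w₀
    subst hs; cases hl; cases hr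
    change (L.supOver hN hψ).IsOver _ _
      (liftη (embHol Vmod isArc) L.supDiagram (anShape (Vmod := Vmod) (isArc := isArc)).obs L.holUniv _)
    rw [liftη_eq graphEmbedding_embHol _ (LiftPair.ofMem mem), LiftPair.hom_ofMem]
    exact L.isOver_sup_of_isOver_hol hN hψ (L.holUniv_isOver mem)

/-- **Push-forward INTO the core `An⊢`**: a member pair of any sink followed by a path into `An⊢` is (trivially) a member there, and the
lift of the composite pair IS the member's homotopy whiskered — that whiskering lies over the core (Rmk 3.5.1) and the lift is the unique
such transformation (abc-iut-f-101's `IsOver.eq_lift`). [cite: MochizukiAbsTopIII2015, Remark 3.5.1 p.78] -/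
theorem supSink_push_monoCore {a n : (supShape Vmod isArc).Vertex} {p q : Path a n} (h : (L.supSink hN hψ n).E p q)
    (s : Path n (monoCore Vmod isArc)) (x : L.supDiagram.obj a) :
    ((L.supSink hN hψ _).η (show (L.supSink hN hψ (monoCore Vmod isArc)).E (p.comp s) (q.comp s) from trivial)).app x =
      eqToHom (L.supDiagram.pathFunctor_comp_obj p s x) ≫
        (L.supDiagram.pathFunctor s).map (((L.supSink hN hψ n).η h).app x) ≫
          eqToHom (L.supDiagram.pathFunctor_comp_obj q s x).symm := by
  have ho := ((L.isOver_supSinkη hN hψ h).whiskerRight s).eq_lift (L.supOver_ff_monoCore hN hψ)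
  change ((L.supOver hN hψ).lift (L.supOver_ff_monoCore hN hψ) (p.comp s) (q.comp s)).app x = _
  rw [← ho]
  simp only [NatTrans.comp_app, eqToHom_app, Functor.whiskerRight_app]
  rfl

/-! ## Push-forward into `An•[𝒳]`: only along loops of `D_{An•}` -/

/-- Components of a doubly `eqToHom`-conjugated natural transformation against a conjugated morphism (bookkeeping). [folklore] -/
private theorem app_conj₂_eq_of_heq {A B : Type*} [Category A] [Category B] {F₁ F₂ F₃ G₁ G₂ G₃ : A ⥤ B}
    (a₁ : F₁ = F₂) (a₂ : F₂ = F₃) (T : F₃ ⟶ G₃) (a₃ : G₃ = G₂) (a₄ : G₂ = G₁) (X : A) {Y Z : B} (g : Y ⟶ Z)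
    (b₁ : F₁.obj X = Y) (b₂ : Z = G₁.obj X) (h : HEq (T.app X) g) :
    (eqToHom a₁ ≫ (eqToHom a₂ ≫ T ≫ eqToHom a₃) ≫ eqToHom a₄).app X = eqToHom b₁ ≫ g ≫ eqToHom b₂ := by
  subst a₁ a₂ a₃ a₄ b₁ b₂
  cases h
  simp

/-- Equal functors act heterogeneously equally on a morphism (bookkeeping). [folklore] -/
private theorem map_heq_of_functor_eq {A B : Type*} [Category A] [Category B] {F G : A ⥤ B} (h : F = G) {Y Z : A}
    (f : Y ⟶ Z) : HEq (F.map f) (G.map f) := by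
  subst h; rfl

/-- A functor applied to an `eqToHom`-conjugate is, heterogeneously, the functor applied to the core (bookkeeping). [folklore] -/
private theorem map_conj_heq {A B : Type*} [Category A] [Category B] (F : A ⥤ B) {a a' b b' : A} (ha : a = a') (hb : b' = b)
    (u : a' ⟶ b') : HEq (F.map (eqToHom ha ≫ u ≫ eqToHom hb)) (F.map u) := by
  subst ha hb; simp

/-- **Push-forward INTO `An•[𝒳]`**: a member pair of the sink at `An•[𝒳]` (an embedded pair of the universal family of `D_{An•}`)
followed by a loop `An•[𝒳] ⟶ An•[𝒳]` of the super-diagram — necessarily a loop of `D_{An•}` (the sieve property) — is the embedded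
post-composed pair, a boundary pair of the (saturated) universal family, whose homotopy is the whiskered lift (abc-iut-L4-t5's
`lift_postcomp_heq`). [cite: MochizukiAbsTopIII2015, Definition 3.5 (ii) p.75] -/
theorem supSink_push_holCore {a : (supShape Vmod isArc).Vertex} {p q : Path a (holCore Vmod isArc)}
    (h : (L.supSink hN hψ (holCore Vmod isArc)).E p q) (s : Path (holCore Vmod isArc) (holCore Vmod isArc)) :
    ∃ h' : (L.supSink hN hψ (holCore Vmod isArc)).E (p.comp s) (q.comp s), ∀ x : L.supDiagram.obj a,
      ((L.supSink hN hψ _).η h').app x = eqToHom (L.supDiagram.pathFunctor_comp_obj p s x) ≫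
        (L.supDiagram.pathFunctor s).map (((L.supSink hN hψ _).η h).app x) ≫
          eqToHom (L.supDiagram.pathFunctor_comp_obj q s x).symm := by
  obtain ⟨w₀⟩ := h
  obtain ⟨src, left, right, mem, hs, hl, hr⟩ := w₀
  subst hs; cases hl; cases hr
  -- the loop lifts along the sieve
  obtain ⟨c', s', hc, hs'⟩ := isSieve_embHol.exists_mapPath s (b' := (anShape (Vmod := Vmod) (isArc := isArc)).obs) rfl
  obtain rfl : c' = (anShape (Vmod := Vmod) (isArc := isArc)).obs := embHol_obj_injective hc
  cases hs'
  -- the pushed pair: a boundary pair of the universal family by post-composition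
  have mem' : L.holUniv.E (left.comp s') (right.comp s') := L.holUniv.isSaturated.postcomp mem s'
  have hp : (embHol Vmod isArc).mapPath (left.comp s') =
      ((embHol Vmod isArc).mapPath left).comp ((embHol Vmod isArc).mapPath s') := Prefunctor.mapPath_comp _ _ _
  have hq : (embHol Vmod isArc).mapPath (right.comp s') =
      ((embHol Vmod isArc).mapPath right).comp ((embHol Vmod isArc).mapPath s') := Prefunctor.mapPath_comp _ _ _
  let w' : LiftPair (embHol Vmod isArc) L.supDiagram (anShape (Vmod := Vmod) (isArc := isArc)).obs L.holUniv
      (((embHol Vmod isArc).mapPath left).comp ((embHol Vmod isArc).mapPath s'))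
      (((embHol Vmod isArc).mapPath right).comp ((embHol Vmod isArc).mapPath s')) :=
    ⟨src, left.comp s', right.comp s', mem', rfl, heq_of_eq hp, heq_of_eq hq⟩
  refine ⟨⟨w'⟩, fun x => ?_⟩
  have e1 : (L.supSink hN hψ (holCore Vmod isArc)).η ⟨w'⟩ = w'.hom := liftη_eq graphEmbedding_embHol _ w'
  have e2 : w'.hom = eqToHom _ ≫ (eqToHom (L.supDiagram.pathFunctor_comapAlong (embHol Vmod isArc) _).symm ≫
      L.holUniv.η mem' ≫ eqToHom (L.supDiagram.pathFunctor_comapAlong (embHol Vmod isArc) _)) ≫ eqToHom _ :=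
    L.supDiagram.transportHom_eq hp hq _
  -- the two homotopies of the universal family are lifts at `An•[𝒳]`, the second the first post-whiskered by `s'`
  have hη : L.holUniv.η mem = L.holOverE.lift (L.holW_ff _ rfl) left right :=
    univFamily_η_eq_lift L.holOverE (· = (anShape (Vmod := Vmod) (isArc := isArc)).obs) L.holW_ff rfl left right mem
  have hη' : L.holUniv.η mem' = L.holOverE.lift (L.holW_ff _ rfl) (left.comp s') (right.comp s') :=
    univFamily_η_eq_lift L.holOverE (· = (anShape (Vmod := Vmod) (isArc := isArc)).obs) L.holW_ff rfl _ _ mem'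
  have h1 : HEq ((L.holUniv.η mem').app x)
      ((Functor.whiskerRight (L.holOverE.lift (L.holW_ff _ rfl) left right)
        ((L.supDiagram.comapAlong (embHol Vmod isArc)).pathFunctor s')).app x) := by
    rw [hη']
    exact NatTrans.app_heq_of_heq rfl HEq.rfl rfl HEq.rfl (heq_of_eq (DiagramOfCategories.pathFunctor_comp _ left s'))
      (heq_of_eq (DiagramOfCategories.pathFunctor_comp _ right s'))
      ((L.holOverE).lift_postcomp_heq (L.holW_ff _ rfl) (L.holW_ff _ rfl) left right s') HEq.rfl
  have h2 : HEq (((L.supDiagram.comapAlong (embHol Vmod isArc)).pathFunctor s').map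
        ((L.holOverE.lift (L.holW_ff _ rfl) left right).app x))
      ((L.supDiagram.pathFunctor ((embHol Vmod isArc).mapPath s')).map ((L.holOverE.lift (L.holW_ff _ rfl) left right).app x)) :=
    map_heq_of_functor_eq (L.supDiagram.pathFunctor_comapAlong (embHol Vmod isArc) s') _
  have h3 : HEq ((L.supDiagram.pathFunctor ((embHol Vmod isArc).mapPath s')).map ((L.holOverE.lift (L.holW_ff _ rfl) left right).app x))
      ((L.supDiagram.pathFunctor ((embHol Vmod isArc).mapPath s')).map
        ((liftη (embHol Vmod isArc) L.supDiagram (anShape (Vmod := Vmod) (isArc := isArc)).obs L.holUniv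
          ⟨LiftPair.ofMem mem⟩).app x)) := by
    have e0 : liftη (embHol Vmod isArc) L.supDiagram (anShape (Vmod := Vmod) (isArc := isArc)).obs L.holUniv
        ⟨LiftPair.ofMem mem⟩ = _ :=
      (liftη_eq graphEmbedding_embHol _ (LiftPair.ofMem mem)).trans (LiftPair.hom_ofMem mem)
    rw [e0, hη]
    simp only [NatTrans.comp_app, eqToHom_app]
    exact (map_conj_heq _ _ _ _).symm
  exact (congrArg (fun t => NatTrans.app t x) (e1.trans e2)).trans
    (app_conj₂_eq_of_heq _ _ _ _ _ x _ _ _ (h1.trans (h2.trans h3)))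

/-- **The push-forward axiom** for the two sinks: into `An⊢` by `supSink_push_monoCore` (from either sink); into `An•[𝒳]` only from
`An•[𝒳]` (`supSink_push_holCore`) — no path returns from `An⊢` (file 1). [cite: MochizukiAbsTopIII2015, Cor 5.10 (iv)(c) p. 148] -/
theorem supSink_push {a n n' : (supShape Vmod isArc).Vertex} {p q : Path a n} (h : (L.supSink hN hψ n).E p q) (s : Path n n')
    (hn' : isObsSup n' = true) :
    ∃ h' : (L.supSink hN hψ n').E (p.comp s) (q.comp s), ∀ x : L.supDiagram.obj a,
      ((L.supSink hN hψ n').η h').app x = eqToHom (L.supDiagram.pathFunctor_comp_obj p s x) ≫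
        (L.supDiagram.pathFunctor s).map (((L.supSink hN hψ n).η h).app x) ≫
          eqToHom (L.supDiagram.pathFunctor_comp_obj q s x).symm := by
  rcases n' with (_ | _) | _
  · exact absurd hn' (by simp [isObsSup])
  · exact ⟨trivial, fun x => L.supSink_push_monoCore hN hψ h s x⟩
  · rcases n with (_ | _) | _
    · exact (h : False).elim
    · exact (isEmpty_path_monoCore_holCore.false s).elim
    · exact L.supSink_push_holCore hN hψ h s

/-! ## The sink system and the family `K` on the common super-diagram -/

/-- **The sink system of the common super-diagram** (abc-iut-f-101's `SinkSystem`: core lifts at `An⊢`, the universal family of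
`D_{An•}` at `An•[𝒳]`). [cite: MochizukiAbsTopIII2015, Cor 5.10 (iv)(c) p. 148] -/
noncomputable def supSinkSystem : SinkSystem L.supDiagram isObsSup where
  E := fun _ n p q => (L.supSink hN hψ n).E p q
  mem_isObs := fun _ _ _ _ h => L.isObsSup_of_mem hN hψ h
  η := fun _ n _ _ h => (L.supSink hN hψ n).η h
  η_self := fun _ _ _ h => L.supSink_η_self hN hψ h
  trans := fun _ _ _ _ _ h₁ h₂ => L.supSink_trans hN hψ h₁ h₂
  precomp := fun _ _ _ _ _ h r => L.supSink_precomp hN hψ h r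
  push := fun _ _ _ _ _ h s hn' => L.supSink_push hN hψ h s hn'

/-- ★ **The family `K` on the common super-diagram** generated by the sink system (abc-iut-f-101's `SinkSystem.family`: Def 3.5 (ii) —
identity, composition, whiskering PROVED by the sink-system theory). [cite: MochizukiAbsTopIII2015, Cor 5.10 (iv)(c) p. 148] -/
noncomputable def holMonoFamily : L.supDiagram.HomotopyFamily :=
  (L.supSinkSystem hN hψ).family

end Sinks



end LogFrobeniusSetting

end Literature.AnabelianGeometry.AbsoluteAnabelian
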